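import Literature.NumberTheory.GaloisRepresentations.LubinTateComparisonGroupLawPoints
import Literature.NumberTheory.GaloisRepresentations.LubinTateComparisonPoints
import Literature.NumberTheory.GaloisRepresentations.LubinTateColeman
import HarnessLib

/-!
# `ϑ` on `𝔪_ℂ`: the comparison series is additive on the points of `𝒪_{ℂ_F}`, and carries
# `f`-torsion to `f'`-torsion; evaluation of composed series (`(R ∘ φ)(y) = R(φ(y))`)

Topic `NumberTheory/GaloisRepresentations`; namespace `Literature.NumberTheory.GaloisRepresentations`.

De Shalit, *Iwasawa theory of elliptic curves with complex multiplication* (1987), I.3.2–3.3 uses the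
isomorphism `θ : Ĝ_m ≃ F_f` over `𝒪̂_{K^nr}` on POINTS: the division points `ω = θ(ζ − 1)` ((5)) and the
support criterion (7) ⟺ (7′) (`θ(S) [+] ω ↔ ς(1+S) − 1`).  For the tree's concrete comparison series
`ϑ = compSeriesC hπ hσ₀ u hε ∈ 𝒪̂_{F^nr}⟦X⟧` between `f = πX + X^q` and `f' = π'X + X^q` (`π' = uπ`,
`LubinTateComparisonUnramified.lean`, `LubinTateComparisonPoints.lean`) evaluated on the open unit ball
`𝔪_ℂ` of `𝒪_{ℂ_F}` (`CBall F`, `maxNilIdealC F`) this file proves: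

* `LubinTate.subst_eq_evT`, `LubinTate.evS_evT`, ★ `LubinTate.evS_subst` — for series `R, φ ∈ S⟦X⟧`
  over a complete linearly topologised ring `S` and `φ(0) = 0`: `R ∘ φ` (Mathlib `PowerSeries.subst`) is the
  topological evaluation `R(φ)` (tree `evT`), and **`(R ∘ φ)(y) = R(φ(y))`** at every point `y` of a closed
  nil ideal (tree `evS`); `LubinTate.evS_map` — `(ι g)(y) = g(y)`;
* ★ `evalPt₁_compSeriesC_addPt` — **`ϑ(F_f(x, y)) = F_{f'}(ϑ x, ϑ y)`** for `x, y ∈ 𝔪_ℂ`, the group laws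
  read on `𝒪_{ℂ_F}` through Mathlib's `FormalGroup.map` of the tree's `formalGroup` along
  `𝒪[F] → 𝒪̂_{F^nr}` and the tree's `addPt` (series identity `subst_ltF_compSeries`, Lubin–Tate (17));
* `coe_evalPt₁_homC_self`, `coe_evalPt₁_homC'_self` — `[π]_f y = πy + y^q`, `[π']_{f'} y = π'y + y^q` read
  in `ℂ_F`; ★ `aeval_ltPoly'_compSeriesC_eq_zero` — **`f(x) = 0 ⟹ f'(ϑ x) = 0`**: `ϑ` carries the `f`-division
  points of level one in `𝔪_ℂ` to `f'`-division points (`ϑ ∘ [π']_f = [π']_{f'} ∘ ϑ`, Lubin–Tate (18));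
* `LubinTate.addPt_zero_right'`, `LubinTate.addPt_zero_left'` — `F(x, 0) = x = F(0, x)` on points for ANY
  formal group law over the coefficient ring (Mathlib `FormalGroup.Xzero_eq_X`), e.g. a mapped one.

Everything is proved; no named facts, no definitions, no instances, no `sorry`.

## References

* [LubinTate1965] J. Lubin, J. Tate, *Formal complex multiplication in local fields*, Ann. of Math. 81
  (1965), Lemma p. 385–386, (16)–(18).
* [deShalit1987] E. de Shalit, *Iwasawa theory of elliptic curves with complex multiplication* (1987),
  I.3.2 (3)–(5), I.3.3 (7)–(7′) (p. 17).
-/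

noncomputable section

open MvPowerSeries
open scoped PowerSeries.WithPiTopology

namespace Literature.NumberTheory.GaloisRepresentations

namespace LubinTate

/-! ### Composition and evaluation of `S`-coefficient series -/

section EvalSubst

variable {S : Type*} [CommRing S] [UniformSpace S] [IsUniformAddGroup S] [IsTopologicalRing S]
  [IsLinearTopology S S] [T2Space S] [CompleteSpace S]
variable (M : NilIdeal S)

omit [IsUniformAddGroup S] [IsTopologicalRing S] [T2Space S] [CompleteSpace S] in
/-- A series without constant term is a point of `S⟦X⟧` (its constant term lies in `M`).
[cite: CasselsFrohlichANT1967, Ch. VI §3.2] -/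
theorem mem_seriesNilIdeal_of_constantCoeff_eq_zero {φ : PowerSeries S}
    (hφ : PowerSeries.constantCoeff φ = 0) : φ ∈ (seriesNilIdeal M).toIdeal := by
  rw [mem_seriesNilIdeal_iff, hφ]; exact M.toIdeal.zero_mem

/-- **`R ∘ φ = R(φ)`**: Mathlib's substitution of a constant-term-free `φ ∈ S⟦X⟧` into `R ∈ S⟦X⟧`
is the topological evaluation of `R` at the point `φ` of `S⟦X⟧` (both have `n`-th coefficient
`Σ_{d ≤ n} R_d · [X^n] φ^d`). [cite: CasselsFrohlichANT1967, Ch. VI §3.2] -/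
theorem subst_eq_evT (φ : PowerSeries S) (hφ : PowerSeries.constantCoeff φ = 0) (R : PowerSeries S) :
    PowerSeries.subst φ R = evT M ⟨φ, mem_seriesNilIdeal_of_constantCoeff_eq_zero M hφ⟩ R := by
  ext n
  have hφs : PowerSeries.HasSubst φ := PowerSeries.HasSubst.of_constantCoeff_zero' hφ
  -- the `n`-th coefficient of `R(φ)` is the (finite) sum `Σ_d R_d [X^n] φ^d`
  have h1 := (PowerSeries.hasSum_aeval ((seriesNilIdeal M).isTopologicallyNilpotent _
    (mem_seriesNilIdeal_of_constantCoeff_eq_zero M hφ)) R).map (PowerSeries.coeff (R := S) n)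
    (PowerSeries.WithPiTopology.continuous_coeff S n)
  have hzero : ∀ d : ℕ, n < d → PowerSeries.coeff n (φ ^ d) = 0 := fun d hd ↦ by
    have hX : (PowerSeries.X : PowerSeries S) ^ d ∣ φ ^ d :=
      pow_dvd_pow_of_dvd (PowerSeries.X_dvd_iff.mpr hφ) d
    exact PowerSeries.X_pow_dvd_iff.mp hX n hd
  have hsupp : (Function.support fun d : ℕ ↦ PowerSeries.coeff d R • PowerSeries.coeff n (φ ^ d)) ⊆
      ↑(Finset.range (n + 1)) := by
    intro d hd
    rw [Finset.coe_range, Set.mem_Iio]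
    by_contra h
    exact hd (by simp only [hzero d (by omega), smul_zero])
  have h2 : HasSum (fun d : ℕ ↦ PowerSeries.coeff d R • PowerSeries.coeff n (φ ^ d))
      (∑ d ∈ Finset.range (n + 1), PowerSeries.coeff d R • PowerSeries.coeff n (φ ^ d)) :=
    hasSum_sum_of_ne_finset_zero fun d hd ↦ Function.notMem_support.mp fun h ↦ hd (hsupp h)
  have h1' : HasSum (fun d : ℕ ↦ PowerSeries.coeff d R • PowerSeries.coeff n (φ ^ d))
      (PowerSeries.coeff n (evT M ⟨φ, mem_seriesNilIdeal_of_constantCoeff_eq_zero M hφ⟩ R)) := by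
    convert h1 using 1
    · funext d
      simp only [Function.comp_apply, map_smul, smul_eq_mul]
    · rfl
  rw [PowerSeries.coeff_subst' hφs R n, finsum_eq_sum_of_support_subset _ hsupp, ← h1'.unique h2]

/-- **`(G(t))(y) = G(t(y))`**: evaluating at `y ∈ M` after translating by a point `t` of `S⟦X⟧`.
[cite: CasselsFrohlichANT1967, Ch. VI §3.2] -/
theorem evS_evT (y : M.toIdeal) (t : (seriesNilIdeal M).toIdeal) (G : PowerSeries S) :
    evS M y (evT M t G) = evS M (evSPt M y t) G := by
  have hc := continuous_evS M y
  have key := MvPowerSeries.comp_aeval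
    (PowerSeries.hasEval ((seriesNilIdeal M).isTopologicallyNilpotent _ t.2)) hc
  have h' := congrArg (fun φ => φ (G : MvPowerSeries Unit S)) key
  simp only [AlgHom.coe_comp, Function.comp_apply] at h'
  exact h'.trans (aeval_congr_family _ _ (funext fun _ => rfl) _)

/-- The value `φ(y)` of a constant-term-free `φ` at `y ∈ M` lies in `M`. [cite: CasselsFrohlichANT1967, Ch. VI §3.2] -/
theorem evS_mem_of_constantCoeff_eq_zero (y : M.toIdeal) {φ : PowerSeries S}
    (hφ : PowerSeries.constantCoeff φ = 0) : evS M y φ ∈ M.toIdeal :=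
  evS_mem M y (mem_seriesNilIdeal_of_constantCoeff_eq_zero M hφ)

/-- ★ **`(R ∘ φ)(y) = R(φ(y))`** for `R, φ ∈ S⟦X⟧`, `φ(0) = 0`, at every point `y` of a closed nil
ideal `M ⊆ S`. [cite: CasselsFrohlichANT1967, Ch. VI §3.2] -/
theorem evS_subst (y : M.toIdeal) {φ : PowerSeries S} (hφ : PowerSeries.constantCoeff φ = 0)
    (R : PowerSeries S) :
    evS M y (PowerSeries.subst φ R) = evS M ⟨evS M y φ, evS_mem_of_constantCoeff_eq_zero M y hφ⟩ R := by
  rw [subst_eq_evT M φ hφ R, evS_evT]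
  rfl

variable {A : Type*} [CommRing A] [UniformSpace A] [DiscreteUniformity A] [Algebra A S]
  [ContinuousSMul A S]

/-- **`(ι g)(y) = g(y)`**: the value at `y ∈ M` of the coefficientwise image of `g ∈ A⟦X⟧` in `S⟦X⟧`
is the value of `g`. [cite: CasselsFrohlichANT1967, Ch. VI §3.2] -/
theorem evS_map (y : M.toIdeal) (g : PowerSeries A) :
    evS M y (g.map (algebraMap A S)) = evalAt M y g := by
  rw [← evalAt_serX M g, evS_evalAt, evSPt_serX]

/-- The value of a constant-term-free `g ∈ A⟦X⟧` at `y` (`evalPt₁`) read in `S`, as an `evS`-value of its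
image. [cite: CasselsFrohlichANT1967, Ch. VI §3.2] -/
theorem coe_evalPt₁_eq_evS_map (g : PowerSeries A) (hg : PowerSeries.constantCoeff g = 0) (y : M.toIdeal) :
    ((evalPt₁ M g hg y : M.toIdeal) : S) = evS M y (g.map (algebraMap A S)) := by
  rw [evS_map, coe_evalPt₁_eq_evalAt]

end EvalSubst

/-! ### `F(x, 0) = x` for a mapped formal group -/

section AddPtZero

variable {A : Type*} [CommRing A] [UniformSpace A] [DiscreteUniformity A]
variable {S : Type*} [CommRing S] [UniformSpace S] [IsUniformAddGroup S] [IsTopologicalRing S]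
  [IsLinearTopology S S] [T2Space S] [CompleteSpace S] [Algebra A S] [ContinuousSMul A S]
variable (M : NilIdeal S) (G : FormalGroup A)

/-- **`x ⊕ 0 = x` on points** for ANY formal group law `G` over the coefficient ring (from Mathlib's
`F(X, 0) = X`, `FormalGroup.Xzero_eq_X`); the tree's `ltAdd_zero` is the Lubin–Tate case.
[cite: CasselsFrohlichANT1967, Ch. VI §3.2 (b)] -/
theorem addPt_zero_right' (x : M.toIdeal) : addPt M G x 0 = x := by
  have key := G.Xzero_eq_X
  have h2 : ∀ s : Fin 2,
      ((![PowerSeries.X, 0] : Fin 2 → MvPowerSeries Unit A) s).constantCoeff = 0 :=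
    fun s => by fin_cases s <;> simp [PowerSeries.X]
  have e := evalPt_congr M key (constantCoeff_subst_zero h2 G.zero_constantCoeff)
    PowerSeries.constantCoeff_X (fun _ => x)
  change evalPt M (subst ![PowerSeries.X, 0] G.toPowerSeries) _ _ = _ at e
  rw [evalPt_subst M h2 _ G.zero_constantCoeff] at e
  have hX : evalPt M (PowerSeries.X : MvPowerSeries Unit A) PowerSeries.constantCoeff_X
      (fun _ => x) = x := evalPt_X M () (fun _ => x)
  rw [hX] at e
  conv_rhs => rw [← e]
  change evalPt M G.toPowerSeries G.zero_constantCoeff ![x, 0] = _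
  congr 1
  funext s
  fin_cases s
  · exact hX.symm
  · apply Subtype.ext
    change ((0 : M.toIdeal) : S) =
      MvPowerSeries.aeval _ ((![PowerSeries.X, 0] : Fin 2 → MvPowerSeries Unit A) 1)
    simp only [Matrix.cons_val_one, Matrix.cons_val_fin_one, map_zero]
    rfl

/-- `0 ⊕ x = x` on points, for a commutative formal group law. [cite: CasselsFrohlichANT1967, Ch. VI §3.2 (b)] -/
theorem addPt_zero_left' [G.IsComm] (x : M.toIdeal) : addPt M G 0 x = x := by
  rw [addPt_comm, addPt_zero_right']

end AddPtZero

end LubinTate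

/-! ### `ϑ` is additive on `𝔪_ℂ` and carries `f`-torsion to `f'`-torsion -/

section ComparisonAddPoints

open ValuativeRel IsLocalRing Field IsNonarchimedeanLocalField LubinTate
open Literature.NumberTheory.PAdicHodge

variable {F : Type} [Field F] [ValuativeRel F] [TopologicalSpace F] [IsNonarchimedeanLocalField F]
variable {π : 𝒪[F]} (hπ : (valuation F).IsUniformizer (π : F))
  {σ₀ : absoluteGaloisGroup F} (hσ₀ : IsAbsArithFrob σ₀) (u : 𝒪[F]ˣ)
  {ε : (maxUnramifiedCompletion F)ˣ}
  (hε : maxUnramifiedCompletion.galAut F σ₀ (ε : maxUnramifiedCompletion F) =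
    algebraMap 𝒪[F] (maxUnramifiedCompletion F) (u : 𝒪[F]) * (ε : maxUnramifiedCompletion F))

/-- The coefficient map `𝒪[F] → 𝒪̂_{F^nr}` (discrete copy) factors through `𝒪̂_{F^nr}` (unfolding).
[folklore] -/
private theorem intToUnrCoeff_eq_comp :
    intToUnrCoeff F = (UnrCoeff.of F).toRingHom.comp (algebraMap 𝒪[F] (maxUnramifiedCompletion F)) := rfl

/-- ★ **`ϑ(F_f(x, y)) = F_{f'}(ϑ x, ϑ y)` on `𝔪_ℂ`** for the concrete comparison series
`ϑ = compSeriesC` of `f = πX + X^q` and `f' = π'X + X^q` (`π' = uπ`): the group laws are read on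
`𝒪_{ℂ_F}` through `FormalGroup.map` along `𝒪[F] → 𝒪̂_{F^nr}` (Lubin–Tate (17) at points; de Shalit's
`θ(x [+] y)`). [cite: LubinTate1965, Lemma p. 385, (17)] [cite: deShalit1987, I.3.2 (5) (p. 17)] -/
theorem evalPt₁_compSeriesC_addPt (x y : (maxNilIdealC F).toIdeal) :
    evalPt₁ (maxNilIdealC F) (compSeriesC hπ hσ₀ u hε) (constantCoeff_compSeriesC hπ hσ₀ u hε)
        (addPt (maxNilIdealC F)
          ((formalGroup (isLTRing_integer F hπ) (isLTSeries_ltPoly F (π := π))).map (intToUnrCoeff F)) x y) =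
      addPt (maxNilIdealC F)
        ((formalGroup (isLTRing_unit_mul hπ u) (isLTSeries_ltPoly F (π := (u : 𝒪[F]) * π))).map
          (intToUnrCoeff F))
        (evalPt₁ (maxNilIdealC F) (compSeriesC hπ hσ₀ u hε) (constantCoeff_compSeriesC hπ hσ₀ u hε) x)
        (evalPt₁ (maxNilIdealC F) (compSeriesC hπ hσ₀ u hε) (constantCoeff_compSeriesC hπ hσ₀ u hε) y) := by
  set ϑ := compSeriesC hπ hσ₀ u hε with hϑdef
  have hϑ0 : PowerSeries.constantCoeff ϑ = 0 := constantCoeff_compSeriesC hπ hσ₀ u hε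
  set G : MvPowerSeries (Fin 2) (UnrCoeff F) :=
    MvPowerSeries.map (intToUnrCoeff F) (ltF (isLTRing_integer F hπ) (isLTSeries_ltPoly F (π := π)))
    with hGdef
  set G' : MvPowerSeries (Fin 2) (UnrCoeff F) :=
    MvPowerSeries.map (intToUnrCoeff F)
      (ltF (isLTRing_unit_mul hπ u) (isLTSeries_ltPoly F (π := (u : 𝒪[F]) * π))) with hG'def
  have hG0 : G.constantCoeff = 0 := by
    rw [hGdef, MvPowerSeries.constantCoeff_map, constantCoeff_ltF, map_zero]
  have hG'0 : G'.constantCoeff = 0 := by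
    rw [hG'def, MvPowerSeries.constantCoeff_map, constantCoeff_ltF, map_zero]
  -- (1) the series identity `ϑ(F_f(X₀,X₁)) = F_{f'}(ϑ X₀, ϑ X₁)` over `𝒪̂_{F^nr}`, on the discrete copy
  have key : PowerSeries.subst G ϑ =
      MvPowerSeries.subst ![PowerSeries.subst (MvPowerSeries.X 0 : MvPowerSeries (Fin 2) (UnrCoeff F)) ϑ,
        PowerSeries.subst (MvPowerSeries.X 1 : MvPowerSeries (Fin 2) (UnrCoeff F)) ϑ] G' := by
    haveI := isAdicComplete_span_unrPi hπ
    have h := subst_ltF_compSeries (algebraMap 𝒪[F] (maxUnramifiedCompletion F))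
      (maxUnramifiedCompletion.galAut F σ₀).toRingHom (isTwistBase_galAut hπ hσ₀)
      (fun a => maxUnramifiedCompletion.galAut_algebraMap σ₀ a) (isLTSeries_ltPoly F (π := π))
      (isLTSeries_ltPoly F (π := (u : 𝒪[F]) * π)) (isLTRing_integer F hπ) (isLTRing_unit_mul hπ u) hε
    set e : maxUnramifiedCompletion F →+* UnrCoeff F := (UnrCoeff.of F).toRingHom with hedef
    set ϑ₀ := ltComparison hπ hσ₀ u hε with hϑ₀def
    have hϑ₀0 : PowerSeries.constantCoeff ϑ₀ = 0 := constantCoeff_ltComparison hπ hσ₀ u hε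
    have hϑe : PowerSeries.map e ϑ₀ = ϑ := rfl
    change PowerSeries.subst _ ϑ₀ = MvPowerSeries.subst ![PowerSeries.subst _ ϑ₀, PowerSeries.subst _ ϑ₀] _ at h
    have h' := congrArg (MvPowerSeries.map (σ := Fin 2) e) h
    have hs1 : PowerSeries.HasSubst (MvPowerSeries.map (algebraMap 𝒪[F] (maxUnramifiedCompletion F))
        (ltF (isLTRing_integer F hπ) (isLTSeries_ltPoly F (π := π)))) :=
      PowerSeries.HasSubst.of_constantCoeff_zero (by
        rw [MvPowerSeries.constantCoeff_map, constantCoeff_ltF, map_zero])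
    have hcs : ∀ i : Fin 2, (PowerSeries.subst
        (MvPowerSeries.X i : MvPowerSeries (Fin 2) (maxUnramifiedCompletion F)) ϑ₀).constantCoeff = 0 := by
      intro i
      rw [PowerSeries.subst_def]
      exact MvPowerSeries.constantCoeff_subst_eq_zero
        (MvPowerSeries.hasSubst_of_constantCoeff_zero fun _ => MvPowerSeries.constantCoeff_X i)
        (fun _ => MvPowerSeries.constantCoeff_X i) hϑ₀0
    have hc : ∀ s : Fin 2,
        ((![PowerSeries.subst (MvPowerSeries.X 0 : MvPowerSeries (Fin 2) (maxUnramifiedCompletion F)) ϑ₀,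
          PowerSeries.subst (MvPowerSeries.X 1 : MvPowerSeries (Fin 2) (maxUnramifiedCompletion F)) ϑ₀]) s
          ).constantCoeff = 0 := by
      intro s
      fin_cases s
      · exact hcs 0
      · exact hcs 1
    have hs2 : MvPowerSeries.HasSubst
        (![PowerSeries.subst (MvPowerSeries.X 0 : MvPowerSeries (Fin 2) (maxUnramifiedCompletion F)) ϑ₀,
          PowerSeries.subst (MvPowerSeries.X 1 : MvPowerSeries (Fin 2) (maxUnramifiedCompletion F)) ϑ₀]) :=
      MvPowerSeries.hasSubst_of_constantCoeff_zero hc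
    rw [PowerSeries.map_subst hs1, MvPowerSeries.map_subst hs2, hϑe, MvPowerSeries.map_map,
      MvPowerSeries.map_map, ← intToUnrCoeff_eq_comp] at h'
    have hX : ∀ i : Fin 2, MvPowerSeries.map e
        (PowerSeries.subst (MvPowerSeries.X i : MvPowerSeries (Fin 2) (maxUnramifiedCompletion F)) ϑ₀) =
        PowerSeries.subst (MvPowerSeries.X i : MvPowerSeries (Fin 2) (UnrCoeff F)) ϑ := fun i => by
      rw [PowerSeries.map_subst (PowerSeries.HasSubst.of_constantCoeff_zero (MvPowerSeries.constantCoeff_X i)),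
        MvPowerSeries.map_X, hϑe]
    have hfam : (fun i : Fin 2 => MvPowerSeries.map e
        ((![PowerSeries.subst (MvPowerSeries.X 0 : MvPowerSeries (Fin 2) (maxUnramifiedCompletion F)) ϑ₀,
          PowerSeries.subst (MvPowerSeries.X 1 : MvPowerSeries (Fin 2) (maxUnramifiedCompletion F)) ϑ₀]) i)) =
        ![PowerSeries.subst (MvPowerSeries.X 0 : MvPowerSeries (Fin 2) (UnrCoeff F)) ϑ,
          PowerSeries.subst (MvPowerSeries.X 1 : MvPowerSeries (Fin 2) (UnrCoeff F)) ϑ] := by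
      funext s
      fin_cases s
      · exact hX 0
      · exact hX 1
    rw [hfam] at h'
    exact h'
  -- (2) evaluate both sides at `(x, y)`
  have hcX : ∀ s : Fin 2, (PowerSeries.subst (MvPowerSeries.X s : MvPowerSeries (Fin 2) (UnrCoeff F)) ϑ).constantCoeff = 0 :=
    fun s ↦ by
      rw [PowerSeries.subst_def]
      exact MvPowerSeries.constantCoeff_subst_eq_zero
        (MvPowerSeries.hasSubst_of_constantCoeff_zero fun _ => MvPowerSeries.constantCoeff_X s)
        (fun _ => MvPowerSeries.constantCoeff_X s) hϑ0
  have hc0 : ∀ s : Fin 2, ((![PowerSeries.subst (MvPowerSeries.X 0 : MvPowerSeries (Fin 2) (UnrCoeff F)) ϑ,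
      PowerSeries.subst (MvPowerSeries.X 1 : MvPowerSeries (Fin 2) (UnrCoeff F)) ϑ]) s).constantCoeff = 0 :=
    fun s ↦ by fin_cases s <;> exact hcX _
  have hL0 : (PowerSeries.subst G ϑ).constantCoeff = 0 := by
    rw [PowerSeries.subst_def]
    exact MvPowerSeries.constantCoeff_subst_eq_zero
      (MvPowerSeries.hasSubst_of_constantCoeff_zero fun _ => hG0) (fun _ => hG0) hϑ0
  have hR0 : (MvPowerSeries.subst ![PowerSeries.subst (MvPowerSeries.X 0 : MvPowerSeries (Fin 2) (UnrCoeff F)) ϑ,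
      PowerSeries.subst (MvPowerSeries.X 1 : MvPowerSeries (Fin 2) (UnrCoeff F)) ϑ] G').constantCoeff = 0 :=
    constantCoeff_subst_zero hc0 hG'0
  have hL := evalPt₁_subst (maxNilIdealC F) G hG0 ϑ hϑ0 hL0 ![x, y]
  have hR := evalPt_subst (maxNilIdealC F) hc0 G' hG'0 hR0 ![x, y]
  have e := evalPt_congr (maxNilIdealC F) key hL0 hR0 ![x, y]
  rw [hL, hR] at e
  have hs : ∀ s : Fin 2, evalPt (maxNilIdealC F)
      (PowerSeries.subst (MvPowerSeries.X s : MvPowerSeries (Fin 2) (UnrCoeff F)) ϑ) (hcX s) ![x, y] =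
        evalPt₁ (maxNilIdealC F) ϑ hϑ0 (![x, y] s) := fun s ↦ by
    rw [evalPt₁_subst (maxNilIdealC F) (MvPowerSeries.X s : MvPowerSeries (Fin 2) (UnrCoeff F))
      (MvPowerSeries.constantCoeff_X s) ϑ hϑ0 (hcX s) ![x, y], evalPt_X]
  change evalPt₁ (maxNilIdealC F) ϑ hϑ0 (evalPt (maxNilIdealC F) G _ ![x, y]) =
    evalPt (maxNilIdealC F) G' _ ![evalPt₁ (maxNilIdealC F) ϑ hϑ0 x, evalPt₁ (maxNilIdealC F) ϑ hϑ0 y]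
  convert e using 2
  funext s
  fin_cases s
  · exact (hs 0).symm
  · exact (hs 1).symm

/-- `[π]_f(y) = f(y) = π y + y^q` on `𝔪_ℂ`, read in `ℂ_F`. [cite: LubinTate1965, §1 Thm. 1 (11)] -/
theorem coe_evalPt₁_homC_self (y : (maxNilIdealC F).toIdeal) :
    ((evalPt₁ (maxNilIdealC F) (homC hπ π) (constantCoeff_homC hπ _) y : CBall F) : CompletedAlgClosure F) =
      Polynomial.aeval ((y : CBall F) : CompletedAlgClosure F) ((ltPoly F π).map (algebraMap 𝒪[F] F)) := by
  have h := coe_evalPt₁_homC_pow hπ 1 y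
  have e : evalPt₁ (maxNilIdealC F) (homC hπ (π ^ 1)) (constantCoeff_homC hπ _) y =
      evalPt₁ (maxNilIdealC F) (homC hπ π) (constantCoeff_homC hπ _) y :=
    evalPt_congr (maxNilIdealC F) (by rw [pow_one]) _ _ _
  rw [e, ltPolyIter_succ, ltPolyIter_zero, Polynomial.comp_X] at h
  exact h

/-- `[π']_{f'}(y) = f'(y) = π' y + y^q` on `𝔪_ℂ` (`π' = uπ`), read in `ℂ_F`. [cite: LubinTate1965, §1 Thm. 1 (11)] -/
theorem coe_evalPt₁_homC'_self (y : (maxNilIdealC F).toIdeal) :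
    ((evalPt₁ (maxNilIdealC F) (homC' hπ u ((u : 𝒪[F]) * π)) (constantCoeff_homC' hπ u _) y : CBall F) :
        CompletedAlgClosure F) =
      Polynomial.aeval ((y : CBall F) : CompletedAlgClosure F)
        ((ltPoly F ((u : 𝒪[F]) * π)).map (algebraMap 𝒪[F] F)) := by
  have hq0 : 0 ≠ residueFieldCard F := by have := one_lt_residueFieldCard F; omega
  have hp : PowerSeries.constantCoeff (((ltPoly F ((u : 𝒪[F]) * π)).map (intToUnrCoeff F) :
      Polynomial (UnrCoeff F)) : PowerSeries (UnrCoeff F)) = 0 := by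
    rw [← PowerSeries.coeff_zero_eq_constantCoeff_apply, Polynomial.coeff_coe, Polynomial.coeff_map]
    simp [ltPoly, hq0]
  have hser : homC' hπ u ((u : 𝒪[F]) * π) = (((ltPoly F ((u : 𝒪[F]) * π)).map (intToUnrCoeff F) :
      Polynomial (UnrCoeff F)) : PowerSeries (UnrCoeff F)) := by
    rw [homC', hom_self_eq, Polynomial.polynomial_map_coe]
  have h1 : evalPt₁ (maxNilIdealC F) (homC' hπ u ((u : 𝒪[F]) * π)) (constantCoeff_homC' hπ u _) y =
      evalPt₁ (maxNilIdealC F) _ hp y := evalPt_congr (maxNilIdealC F) hser _ _ _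
  rw [h1, coe_evalPt₁_coe, Polynomial.aeval_def, Polynomial.eval₂_map, Polynomial.aeval_def,
    Polynomial.eval₂_map,
    show ((Polynomial.eval₂ ((algebraMap (UnrCoeff F) (CBall F)).comp (intToUnrCoeff F)) (y : CBall F)
        (ltPoly F ((u : 𝒪[F]) * π)) : CBall F) : CompletedAlgClosure F) =
      (CBall F).subtype (Polynomial.eval₂ ((algebraMap (UnrCoeff F) (CBall F)).comp (intToUnrCoeff F))
        (y : CBall F) (ltPoly F ((u : 𝒪[F]) * π))) from rfl,
    Polynomial.hom_eval₂]
  congr 1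
  ext a
  rw [RingHom.comp_apply, RingHom.comp_apply, RingHom.comp_apply, Subring.subtype_apply,
    algebraMap_unrCoeff_coe, intToUnrCoeff, RingHom.comp_apply]
  exact toC_algebraMap a

/-- **`ϑ` carries `f`-division points to `f'`-division points**: if `f(x) = 0` for `x ∈ 𝔪_ℂ` then
`f'(ϑ x) = 0` (`ϑ ∘ [π']_f = [π']_{f'} ∘ ϑ` with `[π']_{f'} = f'`, `[π']_f = [u]_f ∘ f`; de Shalit's
`ω = θ(ζ − 1)`). [cite: LubinTate1965, Lemma p. 385, (18)] [cite: deShalit1987, I.3.2 (5) (p. 17)] -/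
theorem aeval_ltPoly'_compSeriesC_eq_zero (x : (maxNilIdealC F).toIdeal)
    (hx : Polynomial.aeval ((x : CBall F) : CompletedAlgClosure F) ((ltPoly F π).map (algebraMap 𝒪[F] F)) = 0) :
    Polynomial.aeval (((evalPt₁ (maxNilIdealC F) (compSeriesC hπ hσ₀ u hε) (constantCoeff_compSeriesC hπ hσ₀ u hε) x :
        (maxNilIdealC F).toIdeal) : CBall F) : CompletedAlgClosure F)
      ((ltPoly F ((u : 𝒪[F]) * π)).map (algebraMap 𝒪[F] F)) = 0 := by
  -- `[π]_f x = 0`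
  have h1 : evalPt₁ (maxNilIdealC F) (homC hπ π) (constantCoeff_homC hπ _) x = 0 := by
    apply Subtype.ext; apply Subtype.ext
    rw [coe_evalPt₁_homC_self hπ x, hx]; rfl
  -- `[π']_f x = [u]_f ([π]_f x) = 0`
  have h2 : evalPt₁ (maxNilIdealC F) (homC hπ ((u : 𝒪[F]) * π)) (constantCoeff_homC hπ _) x = 0 := by
    rw [evalPt₁_homC_mul hπ (u : 𝒪[F]) π x, h1, evalPt₁_zero]
  -- `[π']_{f'} (ϑ x) = ϑ ([π']_f x) = ϑ 0 = 0`
  have h3 := evalPt₁_compSeriesC_homC hπ hσ₀ u hε ((u : 𝒪[F]) * π) x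
  rw [h2, evalPt₁_zero] at h3
  rw [← coe_evalPt₁_homC'_self hπ u, ← h3]
  rfl

end ComparisonAddPoints

end Literature.NumberTheory.GaloisRepresentations

end
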